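import Mathlib
import Summits.Ventures.PercRepro2.HCov
import Summits.Ventures.PercRepro2.RootLeafOCells
import Summits.Ventures.PercRepro2.RootLeafUPocketShare
import Summits.Ventures.PercRepro2.RootLeafUPocket3Graph
import Summits.Ventures.PercRepro2.RootLeafUPocketJoint

/-!
# Joint atoms of a three-terminal pocket with a THREE-point outside pattern
(blind cell PercRepro2, p4 g22; S3 (G4-u), the outside bridge of the boundary-`{u, a₂, c}` pocket class,
proofs/P4-G19-OUTSIDE.md §1 / §7; no definitions)

The o-free masses of the pocket functional `E⁰` (RootLeafUPocket3L) depend on the outside only through the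
pattern of `off ω` on the three terminals `(u, a₂, c)` — five consistent states (`state3_mem_consistent3`).
`prob_eq_sum_joint3` is `PocketJoint.prob_eq_sum_joint` with a three-point outside pattern: an event whose
membership is a Boolean function of (outside 3-pattern, pocket 4-pattern) has probability the sum of the
products `x_v · w_w` over the selected consistent joint states.  `prob_inn_eq_sum` / `prob_off_eq_sum3` are
the one-sided versions (pocket masses as sums of the fifteen pocket atoms, outside masses as sums of the
five outside atoms).
-/

namespace Summit.Ventures.PercRepro2

open UnionCluster CovForm

namespace RootLeafU

namespace PocketJoint3

variable {V : Type*} {E : Type*}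

section States

variable [Fintype E] [Fintype V] [DecidableEq V] (ends : E → Sym2 V)

/-- Every configuration has one of the five consistent patterns (set partitions of three points) on
`(p, q, r)`: the three pair connections `(p,q), (p,r), (q,r)` as Booleans. -/
lemma state3_mem_consistent3 (ω' : Config E) (p q r : V) :
    (decide (Conn ends ω' p q), decide (Conn ends ω' p r), decide (Conn ends ω' q r)) ∈
      ({(false, false, false), (false, false, true), (false, true, false), (true, false, false),
        (true, true, true)} : Finset (Bool × Bool × Bool)) := by
  have t1 : Conn ends ω' p q → Conn ends ω' p r → Conn ends ω' q r :=
    fun h1 h2 => conn_trans (conn_symm h1) h2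
  have t2 : Conn ends ω' p q → Conn ends ω' q r → Conn ends ω' p r := fun h1 h2 => conn_trans h1 h2
  have t3 : Conn ends ω' p r → Conn ends ω' q r → Conn ends ω' p q :=
    fun h1 h2 => conn_trans h1 (conn_symm h2)
  simp only [Finset.mem_insert, Finset.mem_singleton, Prod.mk.injEq]
  by_cases c1 : Conn ends ω' p q <;> by_cases c2 : Conn ends ω' p r <;> by_cases c3 : Conn ends ω' q r <;>
    simp_all

end States

section Joint

variable [Fintype E] [DecidableEq E] [Fintype V] [DecidableEq V] {R : Type*} [CommRing R] (p : E → R)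
variable {ends : E → Sym2 V} {P : Set V} {off inn : Config E → Config E}

/-- Additivity over the joint cells with a three-point outside pattern: an event whose membership is a
Boolean function `φ` of (the outside pattern of `off ω` on `(p₁, q₁, r₁)`, the pocket pattern of `inn ω` on
`(p₂, q₂, r₂, s₂)`) has probability the sum, over the consistent joint states selected by `φ`, of the
PRODUCTS of the outside and the pocket atom probabilities. -/
theorem prob_eq_sum_joint3
    (hoff : (∀ ω e, e ∈ touches ends P → off ω e = false) ∧ (∀ ω e, e ∉ touches ends P → off ω e = ω e))
    (hinn : (∀ ω e, e ∈ touches ends P → inn ω e = ω e) ∧ (∀ ω e, e ∉ touches ends P → inn ω e = false))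
    (p₁ q₁ r₁ p₂ q₂ r₂ s₂ : V) (M : Set (Config E))
    (φ : (Bool × Bool × Bool) × (Bool × Bool × Bool × Bool × Bool × Bool) → Bool)
    (hM : ∀ ω, ω ∈ M ↔ φ ((decide (Conn ends (off ω) p₁ q₁), decide (Conn ends (off ω) p₁ r₁), decide (Conn ends (off ω) q₁ r₁)), (decide (Conn ends (inn ω) p₂ q₂), decide (Conn ends (inn ω) p₂ r₂), decide (Conn ends (inn ω) p₂ s₂), decide (Conn ends (inn ω) q₂ r₂), decide (Conn ends (inn ω) q₂ s₂), decide (Conn ends (inn ω) r₂ s₂))) = true) :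
    prob p M = ∑ v ∈ (({(false, false, false), (false, false, true), (false, true, false), (true, false, false),
        (true, true, true)} : Finset (Bool × Bool × Bool)) ×ˢ ({(false, false, false, false, false, false), (false, false, false, false, false, true),
      (false, false, false, false, true, false), (false, false, false, true, false, false),
      (false, false, true, false, false, false), (false, true, false, false, false, false),
      (true, false, false, false, false, false), (false, false, false, true, true, true),
      (false, true, true, false, false, true), (true, false, true, false, true, false),
      (true, true, false, true, false, false), (true, false, false, false, false, true),
      (false, true, false, false, true, false), (false, false, true, true, false, false),
      (true, true, true, true, true, true)} : Finset (Bool × Bool × Bool × Bool × Bool × Bool))).filter (fun v => φ v = true),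
      prob p {ω : Config E | off ω ∈ {ω' : Config E | (decide (Conn ends ω' p₁ q₁), decide (Conn ends ω' p₁ r₁), decide (Conn ends ω' q₁ r₁)) = v.1}} * prob p {ω : Config E | inn ω ∈ {ω' : Config E | (decide (Conn ends ω' p₂ q₂), decide (Conn ends ω' p₂ r₂), decide (Conn ends ω' p₂ s₂), decide (Conn ends ω' q₂ r₂), decide (Conn ends ω' q₂ s₂), decide (Conn ends ω' r₂ s₂)) = v.2}} := by
  have hMeq : M = ⋃ v ∈ (({(false, false, false), (false, false, true), (false, true, false), (true, false, false),
        (true, true, true)} : Finset (Bool × Bool × Bool)) ×ˢ ({(false, false, false, false, false, false), (false, false, false, false, false, true),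
      (false, false, false, false, true, false), (false, false, false, true, false, false),
      (false, false, true, false, false, false), (false, true, false, false, false, false),
      (true, false, false, false, false, false), (false, false, false, true, true, true),
      (false, true, true, false, false, true), (true, false, true, false, true, false),
      (true, true, false, true, false, false), (true, false, false, false, false, true),
      (false, true, false, false, true, false), (false, false, true, true, false, false),
      (true, true, true, true, true, true)} : Finset (Bool × Bool × Bool × Bool × Bool × Bool))).filter (fun v => φ v = true),
      ({ω : Config E | off ω ∈ {ω' : Config E | (decide (Conn ends ω' p₁ q₁), decide (Conn ends ω' p₁ r₁), decide (Conn ends ω' q₁ r₁)) = v.1}} ∩ {ω : Config E | inn ω ∈ {ω' : Config E | (decide (Conn ends ω' p₂ q₂), decide (Conn ends ω' p₂ r₂), decide (Conn ends ω' p₂ s₂), decide (Conn ends ω' q₂ r₂), decide (Conn ends ω' q₂ s₂), decide (Conn ends ω' r₂ s₂)) = v.2}}) := by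
    ext ω
    simp only [Set.mem_iUnion, Finset.mem_filter, Finset.mem_product, exists_prop, Set.mem_inter_iff,
      Set.mem_setOf_eq]
    constructor
    · intro h
      exact ⟨_, ⟨⟨state3_mem_consistent3 ends (off ω) p₁ q₁ r₁,
        PocketJoint.state4_mem_consistent4 ends (inn ω) p₂ q₂ r₂ s₂⟩, (hM ω).1 h⟩, rfl, rfl⟩
    · rintro ⟨v, ⟨_, hφ⟩, hv1, hv2⟩
      apply (hM ω).2
      rw [← hφ]
      congr 1
      exact Prod.ext hv1 hv2
  classical
  rw [hMeq, RootLeafO.prob_biUnion]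
  · apply Finset.sum_congr rfl
    intro v _
    exact Pocket.prob_off_inter_inn p hoff hinn _ _
  · intro v _ w _ hvw
    rw [Set.disjoint_left]
    rintro ω ⟨h1, h2⟩ ⟨h3, h4⟩
    apply hvw
    simp only [Set.mem_setOf_eq] at h1 h2 h3 h4
    exact Prod.ext (h1.symm.trans h3) (h2.symm.trans h4)

/-- A pocket event (a Boolean function `φ` of the pattern of `inn ω` on `(p₂, q₂, r₂, s₂)`) has probability
the sum of the selected pocket atoms. -/
theorem prob_inn_eq_sum (p₂ q₂ r₂ s₂ : V) (Z : Set (Config E))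
    (φ : (Bool × Bool × Bool × Bool × Bool × Bool) → Bool)
    (hZ : ∀ ω', ω' ∈ Z ↔ φ (decide (Conn ends ω' p₂ q₂), decide (Conn ends ω' p₂ r₂), decide (Conn ends ω' p₂ s₂), decide (Conn ends ω' q₂ r₂), decide (Conn ends ω' q₂ s₂), decide (Conn ends ω' r₂ s₂)) = true) :
    prob p {ω : Config E | inn ω ∈ Z} = ∑ w ∈ (({(false, false, false, false, false, false), (false, false, false, false, false, true),
      (false, false, false, false, true, false), (false, false, false, true, false, false),
      (false, false, true, false, false, false), (false, true, false, false, false, false),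
      (true, false, false, false, false, false), (false, false, false, true, true, true),
      (false, true, true, false, false, true), (true, false, true, false, true, false),
      (true, true, false, true, false, false), (true, false, false, false, false, true),
      (false, true, false, false, true, false), (false, false, true, true, false, false),
      (true, true, true, true, true, true)} : Finset (Bool × Bool × Bool × Bool × Bool × Bool))).filter (fun w => φ w = true),
      prob p {ω : Config E | inn ω ∈ {ω' : Config E | (decide (Conn ends ω' p₂ q₂), decide (Conn ends ω' p₂ r₂), decide (Conn ends ω' p₂ s₂), decide (Conn ends ω' q₂ r₂), decide (Conn ends ω' q₂ s₂), decide (Conn ends ω' r₂ s₂)) = w}} := by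
  have hMeq : {ω : Config E | inn ω ∈ Z} = ⋃ w ∈ (({(false, false, false, false, false, false), (false, false, false, false, false, true),
      (false, false, false, false, true, false), (false, false, false, true, false, false),
      (false, false, true, false, false, false), (false, true, false, false, false, false),
      (true, false, false, false, false, false), (false, false, false, true, true, true),
      (false, true, true, false, false, true), (true, false, true, false, true, false),
      (true, true, false, true, false, false), (true, false, false, false, false, true),
      (false, true, false, false, true, false), (false, false, true, true, false, false),
      (true, true, true, true, true, true)} : Finset (Bool × Bool × Bool × Bool × Bool × Bool))).filter (fun w => φ w = true),
      {ω : Config E | inn ω ∈ {ω' : Config E | (decide (Conn ends ω' p₂ q₂), decide (Conn ends ω' p₂ r₂), decide (Conn ends ω' p₂ s₂), decide (Conn ends ω' q₂ r₂), decide (Conn ends ω' q₂ s₂), decide (Conn ends ω' r₂ s₂)) = w}} := by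
    ext ω
    simp only [Set.mem_iUnion, Finset.mem_filter, exists_prop, Set.mem_setOf_eq]
    constructor
    · intro h
      exact ⟨_, ⟨PocketJoint.state4_mem_consistent4 ends (inn ω) p₂ q₂ r₂ s₂, (hZ (inn ω)).1 h⟩, rfl⟩
    · rintro ⟨w, ⟨_, hφ⟩, hw⟩
      apply (hZ (inn ω)).2
      rw [← hφ, hw]
  classical
  rw [hMeq, RootLeafO.prob_biUnion]
  intro v _ w _ hvw
  rw [Set.disjoint_left]
  rintro ω h1 h3
  apply hvw
  simp only [Set.mem_setOf_eq] at h1 h3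
  exact h1.symm.trans h3

/-- An outside event (a Boolean function `φ` of the pattern of `off ω` on `(p₁, q₁, r₁)`) has probability
the sum of the selected outside atoms. -/
theorem prob_off_eq_sum3 (p₁ q₁ r₁ : V) (Z : Set (Config E))
    (φ : (Bool × Bool × Bool) → Bool)
    (hZ : ∀ ω', ω' ∈ Z ↔ φ (decide (Conn ends ω' p₁ q₁), decide (Conn ends ω' p₁ r₁), decide (Conn ends ω' q₁ r₁)) = true) :
    prob p {ω : Config E | off ω ∈ Z} = ∑ v ∈ (({(false, false, false), (false, false, true), (false, true, false), (true, false, false),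
        (true, true, true)} : Finset (Bool × Bool × Bool))).filter (fun v => φ v = true),
      prob p {ω : Config E | off ω ∈ {ω' : Config E | (decide (Conn ends ω' p₁ q₁), decide (Conn ends ω' p₁ r₁), decide (Conn ends ω' q₁ r₁)) = v}} := by
  have hMeq : {ω : Config E | off ω ∈ Z} = ⋃ v ∈ (({(false, false, false), (false, false, true), (false, true, false), (true, false, false),
        (true, true, true)} : Finset (Bool × Bool × Bool))).filter (fun v => φ v = true),
      {ω : Config E | off ω ∈ {ω' : Config E | (decide (Conn ends ω' p₁ q₁), decide (Conn ends ω' p₁ r₁), decide (Conn ends ω' q₁ r₁)) = v}} := by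
    ext ω
    simp only [Set.mem_iUnion, Finset.mem_filter, exists_prop, Set.mem_setOf_eq]
    constructor
    · intro h
      exact ⟨_, ⟨state3_mem_consistent3 ends (off ω) p₁ q₁ r₁, (hZ (off ω)).1 h⟩, rfl⟩
    · rintro ⟨v, ⟨_, hφ⟩, hv⟩
      apply (hZ (off ω)).2
      rw [← hφ, hv]
  classical
  rw [hMeq, RootLeafO.prob_biUnion]
  intro v _ w _ hvw
  rw [Set.disjoint_left]
  rintro ω h1 h3
  apply hvw
  simp only [Set.mem_setOf_eq] at h1 h3
  exact h1.symm.trans h3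

end Joint

end PocketJoint3

end RootLeafU

end Summit.Ventures.PercRepro2
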